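import Summits.FinalStateConjecture.FinalStateConjecture.Theses.PhaseMixingCapture
import Literature.Geometry.Lorentzian.ConstraintFamilies
import Literature.Geometry.Lorentzian.TrivialDataAdmissible

/-!
# `WeakCosmicCensorshipMGHD` (crux `stmt-FinalStateConjecture-9952`): the receding gauge family —
# part 1: the deformation maps and the family `F(c) = φ_c^* trivialData`

Support file of the crux disprover (cdisprove seat, cycle 3), `sorry`-free, no named facts; part 1
of 3 (`RecedingGaugeDeformation` → `RecedingGaugeAdmissible` → `RecedingGauge`, the last carrying
the theorem `exists_admissible_smoothFamily_not_uniformly_close` and the discussion).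

Construction. `φ_c(y) = y + Θ(c₀, y)`, `Θ(t, y) = (λ/t) G(t y − v)` with `G(z) = β(z) z`, `β` a bump
at `0` (`= 1` on the ball of radius `1/8`, `= 0` off the ball of radius `1/4`), `v` a unit vector,
`λ > 0` small. Then `DΦ̂_c(y) = 1 + λ DG(c₀ y − v)` (the prefactor `1/c₀` cancels, `hasFDerivAt_Θ`),
`= (1 + λ) 1` at the centre `y = v/c₀` (`fderiv_recFun_centre`) and `= 1` off the ball
`B(v/c₀, 1/(4|c₀|))` (`fderiv_recFun_of_far`); `Θ` is JOINTLY smooth on `ℝ × ℝ³` (`contDiff_Θ`: at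
`t = 0` it vanishes on a neighbourhood, `|t| ‖y‖ < 3/4 ⇒ ‖t y − v‖ > 1/4`). The family is the
pullback `F(c) = φ_c^* trivialData` (`recFam`, via the tree's `InitialDataSet.comap`), with
`F(0) = trivialData` (`recFam_zero`), scalar product `δ(DΦ̂_c ·, DΦ̂_c ·)` (`recFam_h_inner_apply`),
`k = 0` (`recFam_k_apply`), equal to the trivial datum where `|c₀| ‖y‖ < 3/4`
(`recFam_h_inner_of_norm_lt`) and `= (1 + λ)² δ` at the centre (`recFam_h_inner_centre`).

## References

* R. Bartnik, J. Isenberg, *The constraint equations* (2004), §2 (pullback of data).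
* D. Christodoulou, CQG 16 (1999) A23–A35, p. A24 (families of data; genericity).
-/

noncomputable section

-- instance search through nested operator types (as in `ConstraintFamilies`)
set_option maxSynthPendingDepth 3
set_option linter.dupNamespace false

open Bundle TopologicalSpace Manifold Set Function Filter Metric Asymptotics Bornology
open scoped ContDiff Topology InnerProductSpace RealInnerProductSpace

namespace Summit.FinalStateConjecture.FinalStateConjecture.Theorems.WeakCosmicCensorshipMGHD.Negative

open Literature.Geometry.Lorentzian

/-! ## §1 The profile: a unit vector, a bump, the vector field `G(z) = β(z) z` -/

section Profile

/-- The parameter space `ℝ¹` of one-parameter families. -/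
abbrev P1 : Type := EuclideanSpace ℝ (Fin 1)

/-- Two parameters of `ℝ¹` with the same coordinate are equal. -/
theorem p1_ext {c c' : P1} (h : c 0 = c' 0) : c = c' := by
  ext i
  fin_cases i
  exact h

/-- A nonzero parameter has nonzero coordinate. -/
theorem p1_ne_zero {c : P1} (h : c ≠ 0) : c 0 ≠ 0 := fun h0 ↦ h (p1_ext (by simpa using h0))

/-- The direction of recession: the first coordinate unit vector `v` of `ℝ³`. -/
def dir : E3 := EuclideanSpace.single (0 : Fin 3) (1 : ℝ)

/-- `v` is a unit vector. -/
@[simp] theorem norm_dir : ‖dir‖ = 1 := by simp [dir]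

/-- `⟪v, v⟫ = 1`. -/
theorem inner_dir_dir : ⟪dir, dir⟫ = 1 := by
  rw [real_inner_self_eq_norm_sq, norm_dir]; norm_num

/-- `v ≠ 0`. -/
theorem dir_ne_zero : dir ≠ 0 := fun h ↦ by simpa [h] using norm_dir

/-- The bump `β`: `= 1` on `closedBall 0 (1/8)`, supported in `ball 0 (1/4)`. -/
def bumpβ : ContDiffBump (0 : E3) := ⟨1 / 8, 1 / 4, by norm_num, by norm_num⟩

/-- The outer radius of `β` is `1/4`. -/
@[simp] theorem bumpβ_rOut : bumpβ.rOut = 1 / 4 := rfl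

/-- `β(0) = 1`. -/
theorem bumpβ_zero : (bumpβ : E3 → ℝ) 0 = 1 :=
  bumpβ.one_of_mem_closedBall (mem_closedBall_self (by norm_num [bumpβ]))

/-- `β` vanishes off the ball of radius `1/4`. -/
theorem bumpβ_eq_zero {z : E3} (hz : 1 / 4 ≤ ‖z‖) : (bumpβ : E3 → ℝ) z = 0 :=
  bumpβ.zero_of_le_dist (by simpa using hz)

/-- The compactly supported vector field `G(z) = β(z) z`. -/
def G (z : E3) : E3 := (bumpβ : E3 → ℝ) z • z

/-- `G` is smooth. -/
theorem contDiff_G : ContDiff ℝ ∞ G :=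
  (bumpβ.contDiff (n := ⊤)).smul contDiff_id

/-- `G` vanishes off the ball of radius `1/4`. -/
theorem G_eq_zero {z : E3} (hz : 1 / 4 ≤ ‖z‖) : G z = 0 := by
  rw [G, bumpβ_eq_zero hz, zero_smul]

/-- `G(0) = 0`. -/
@[simp] theorem G_zero : G 0 = 0 := by simp [G]

/-- `G` vanishes on the open set `{1/4 < ‖z‖}`, hence so does its derivative. -/
theorem fderiv_G_eq_zero {z : E3} (hz : 1 / 4 < ‖z‖) : fderiv ℝ G z = 0 := by
  have hev : G =ᶠ[𝓝 z] fun _ ↦ 0 := by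
    have hopen : IsOpen {w : E3 | 1 / 4 < ‖w‖} := isOpen_lt continuous_const continuous_norm
    filter_upwards [hopen.mem_nhds hz] with w hw
    exact G_eq_zero (le_of_lt hw)
  rw [hev.fderiv_eq]
  exact fderiv_const_apply 0

/-- The derivative of `G` at the centre is the identity (`β ≡ 1` near `0`). -/
theorem hasFDerivAt_G_zero : HasFDerivAt G (ContinuousLinearMap.id ℝ E3) 0 := by
  have hβ : HasFDerivAt (bumpβ : E3 → ℝ) (fderiv ℝ (bumpβ : E3 → ℝ) 0) 0 :=
    ((bumpβ.contDiff (n := ⊤)).differentiable (by simp) 0).hasFDerivAt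
  have h := hβ.smul (hasFDerivAt_id (𝕜 := ℝ) (0 : E3))
  refine h.congr_fderiv ?_
  ext w
  simp [bumpβ_zero]

/-- `DG(0) = 1`. -/
theorem fderiv_G_zero : fderiv ℝ G 0 = ContinuousLinearMap.id ℝ E3 := hasFDerivAt_G_zero.fderiv

/-- `G` is differentiable. -/
theorem differentiable_G : Differentiable ℝ G := contDiff_G.differentiable (by simp)

/-- A uniform bound for `DG` (continuous with compact support). -/
theorem exists_bound_fderiv_G : ∃ C : ℝ, 0 ≤ C ∧ ∀ z, ‖fderiv ℝ G z‖ ≤ C := by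
  have hcont : Continuous fun z ↦ ‖fderiv ℝ G z‖ := (contDiff_G.continuous_fderiv (by simp)).norm
  have hsuppG : HasCompactSupport G := by
    refine HasCompactSupport.of_support_subset_isCompact (isCompact_closedBall (0 : E3) (1 / 4)) ?_
    intro z hz
    rw [mem_closedBall, dist_zero_right]
    by_contra h
    exact hz (G_eq_zero (le_of_lt (not_le.1 h)))
  have hsupp : HasCompactSupport fun z ↦ ‖fderiv ℝ G z‖ := (hsuppG.fderiv ℝ).norm
  obtain ⟨C₀, hC₀⟩ := hcont.bddAbove_range_of_hasCompactSupport hsupp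
  exact ⟨max C₀ 0, le_max_right _ _, fun z ↦ (hC₀ ⟨z, rfl⟩).trans (le_max_left _ _)⟩

end Profile

/-! ## §2 The deformation `Θ(t, y) = (λ/t) G(t y − v)` and the maps `φ_c(y) = y + Θ(c₀, y)` -/

section Deform

variable (lam : ℝ)

/-- The displacement `Θ_λ(t, y) = (λ t⁻¹) G(t y − v)` (with Lean's `0⁻¹ = 0`, so `Θ(0, ·) = 0`). -/
def Θ (t : ℝ) (y : E3) : E3 := (lam * t⁻¹) • G (t • y - dir)

/-- `Θ(0, ·) = 0`. -/
theorem Θ_zero_left (y : E3) : Θ lam 0 y = 0 := by simp [Θ]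

/-- Off the ball `B(v/t, 1/(4|t|))` the displacement vanishes: if `1/4 ≤ ‖t y − v‖`. -/
theorem Θ_eq_zero {t : ℝ} {y : E3} (h : 1 / 4 ≤ ‖t • y - dir‖) : Θ lam t y = 0 := by
  rw [Θ, G_eq_zero h, smul_zero]

/-- Near `t = 0` the displacement vanishes identically: `|t| (‖y‖ + 1) < 3/4 ⇒ ‖t y − v‖ > 1/4`. -/
theorem norm_sub_dir_gt {t : ℝ} {y : E3} (h : |t| * ‖y‖ < 3 / 4) : 1 / 4 < ‖t • y - dir‖ := by
  have h1 : ‖dir‖ - ‖t • y‖ ≤ ‖t • y - dir‖ := by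
    rw [← norm_neg (t • y - dir), neg_sub]; exact norm_sub_norm_le _ _
  rw [norm_dir, norm_smul, Real.norm_eq_abs] at h1
  linarith

/-- **Joint smoothness of `Θ` on `ℝ × ℝ³`.** At `t ≠ 0` it is a composite of smooth maps; at
`t = 0` it vanishes on a neighbourhood. -/
theorem contDiff_Θ : ContDiff ℝ ∞ (fun p : ℝ × E3 ↦ Θ lam p.1 p.2) := by
  refine contDiff_iff_contDiffAt.2 fun p ↦ ?_
  by_cases ht : p.1 = 0
  · -- locally zero
    have hev : (fun q : ℝ × E3 ↦ Θ lam q.1 q.2) =ᶠ[𝓝 p] fun _ ↦ 0 := by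
      have hcont : Continuous fun q : ℝ × E3 ↦ |q.1| * ‖q.2‖ :=
        (continuous_abs.comp continuous_fst).mul (continuous_norm.comp continuous_snd)
      have hopen : IsOpen {q : ℝ × E3 | |q.1| * ‖q.2‖ < 3 / 4} := isOpen_lt hcont continuous_const
      have hp : p ∈ {q : ℝ × E3 | |q.1| * ‖q.2‖ < 3 / 4} := by
        show |p.1| * ‖p.2‖ < 3 / 4
        rw [ht]; norm_num
      filter_upwards [hopen.mem_nhds hp] with q hq
      exact Θ_eq_zero lam (le_of_lt (norm_sub_dir_gt hq))
    exact (contDiffAt_const (c := (0 : E3))).congr_of_eventuallyEq hev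
  · have h1 : ContDiffAt ℝ ∞ (fun q : ℝ × E3 ↦ lam * q.1⁻¹) p :=
      contDiffAt_const.mul ((contDiffAt_inv ℝ ht).comp p contDiffAt_fst)
    have h2 : ContDiffAt ℝ ∞ (fun q : ℝ × E3 ↦ G (q.1 • q.2 - dir)) p :=
      contDiff_G.contDiffAt.comp p ((contDiffAt_fst.smul contDiffAt_snd).sub contDiffAt_const)
    exact (h1.smul h2).congr_of_eventuallyEq (Eventually.of_forall fun q ↦ rfl)

/-- **The derivative of `Θ(t, ·)`: `λ DG(t y − v)`** (for `t ≠ 0` the inner factor `t` cancels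
the prefactor `t⁻¹`; for `t = 0` both sides vanish, `DG(−v) = 0`). -/
theorem hasFDerivAt_Θ (t : ℝ) (y : E3) :
    HasFDerivAt (Θ lam t) (lam • fderiv ℝ G (t • y - dir)) y := by
  by_cases ht : t = 0
  · subst ht
    have h0 : fderiv ℝ G ((0 : ℝ) • y - dir) = 0 := by
      apply fderiv_G_eq_zero
      rw [zero_smul, zero_sub, norm_neg, norm_dir]; norm_num
    rw [h0, smul_zero]
    have : Θ lam 0 = fun _ ↦ (0 : E3) := funext (Θ_zero_left lam)
    rw [this]
    exact hasFDerivAt_const 0 y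
  · have hin : HasFDerivAt (fun y : E3 ↦ t • y - dir) (t • ContinuousLinearMap.id ℝ E3) y :=
      ((hasFDerivAt_id y).const_smul t).sub_const dir
    have hG : HasFDerivAt G (fderiv ℝ G (t • y - dir)) (t • y - dir) :=
      (differentiable_G _).hasFDerivAt
    have hcomp := (hG.comp y hin).const_smul (lam * t⁻¹)
    refine hcomp.congr_fderiv ?_
    rw [ContinuousLinearMap.comp_smul, ContinuousLinearMap.comp_id, smul_smul,
      inv_mul_cancel_right₀ ht]

/-- `D_yΘ(t, y) = λ DG(t y − v)`. -/
theorem fderiv_Θ (t : ℝ) (y : E3) : fderiv ℝ (Θ lam t) y = lam • fderiv ℝ G (t • y - dir) :=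
  (hasFDerivAt_Θ lam t y).fderiv

/-- The deformation maps on `ℝ³`: `Φ̂_c(y) = y + Θ(c₀, y)`. -/
def recFun (c : P1) (y : E3) : E3 := y + Θ lam (c 0) y

/-- `Φ̂_0 = id`. -/
theorem recFun_zero : recFun lam 0 = id := by
  funext y; simp [recFun, Θ_zero_left]

/-- `(c, y) ↦ Φ̂_c(y)` is jointly smooth. -/
theorem contDiff_recFun : ContDiff ℝ ∞ (fun q : P1 × E3 ↦ recFun lam q.1 q.2) := by
  unfold recFun
  refine contDiff_snd.add ?_
  have h0 : ContDiff ℝ ∞ (fun c : P1 ↦ c 0) := contDiff_piLp_apply (p := 2) (i := (0 : Fin 1))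
  have hproj : ContDiff ℝ ∞ (fun q : P1 × E3 ↦ ((q.1 0 : ℝ), q.2)) :=
    (h0.comp contDiff_fst).prodMk contDiff_snd
  exact (contDiff_Θ lam).comp hproj

/-- Each `Φ̂_c` is smooth. -/
theorem contDiff_recFun_right (c : P1) : ContDiff ℝ ∞ (recFun lam c) :=
  (contDiff_recFun lam).comp (contDiff_const.prodMk contDiff_id)

/-- `DΦ̂_c(y) = 1 + λ DG(c₀ y − v)`. -/
theorem hasFDerivAt_recFun (c : P1) (y : E3) :
    HasFDerivAt (recFun lam c) (1 + lam • fderiv ℝ G ((c 0) • y - dir)) y :=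
  (hasFDerivAt_id y).add (hasFDerivAt_Θ lam (c 0) y)

/-- `DΦ̂_c(y) = 1 + λ DG(c₀ y − v)` (as `fderiv`). -/
theorem fderiv_recFun (c : P1) (y : E3) :
    fderiv ℝ (recFun lam c) y = 1 + lam • fderiv ℝ G ((c 0) • y - dir) :=
  (hasFDerivAt_recFun lam c y).fderiv

/-- At the centre `y = v/c₀` (`c₀ ≠ 0`): `DΦ̂_c = (1 + λ) 1`. -/
theorem fderiv_recFun_centre {c : P1} (hc : c 0 ≠ 0) :
    fderiv ℝ (recFun lam c) ((c 0)⁻¹ • dir) = (1 + lam) • (1 : E3 →L[ℝ] E3) := by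
  rw [fderiv_recFun, smul_smul, mul_inv_cancel₀ hc, one_smul, sub_self, fderiv_G_zero, add_smul,
    one_smul]
  rfl

/-- Off the moving ball: if `1/4 < ‖c₀ y − v‖` then `DΦ̂_c(y) = 1`. -/
theorem fderiv_recFun_of_far {c : P1} {y : E3} (h : 1 / 4 < ‖(c 0) • y - dir‖) :
    fderiv ℝ (recFun lam c) y = 1 := by
  rw [fderiv_recFun, fderiv_G_eq_zero h, smul_zero, add_zero]

end Deform

/-! ## §3 The maps `φ_c` of the slice and the family `F c = φ_c^* trivialData` -/

section FamilyDef

variable (lam : ℝ)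

/-- The deformation maps as self-maps of the Minkowski slice `ℝ³ = Minkowski.slice`. -/
def recPhi (c : P1) (y : Minkowski.slice) : Minkowski.slice :=
  ⟨recFun lam c y, Minkowski.mem_slice _⟩

/-- The representative of `φ_c`. -/
@[simp] theorem coe_recPhi (c : P1) (y : Minkowski.slice) :
    (recPhi lam c y : E3) = recFun lam c y := rfl

/-- Each `φ_c` is smooth (`C^{∞+1} = C^∞`). -/
theorem contMDiff_recPhi (c : P1) : ContMDiff 𝓘(ℝ, E3) 𝓘(ℝ, E3) (∞ + 1) (recPhi lam c) := fun y ↦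
  (ChartedSpace.liftPropWithinAt_subtypeVal_comp_iff (recPhi lam c) Set.univ y).mp
    ((((contDiff_recFun_right lam c).contMDiff).comp contMDiff_subtype_val) y)

/-- The differential of `φ_c` is the Fréchet derivative of `Φ̂_c`. -/
theorem mfderiv_recPhi_apply (c : P1) (y : Minkowski.slice) (w : E3) :
    mfderiv 𝓘(ℝ, E3) 𝓘(ℝ, E3) (recPhi lam c) y w = fderiv ℝ (recFun lam c) y w :=
  OpensChart.mfderiv_apply_of_repr (f := recPhi lam c) (fun _ ↦ rfl)
    (((contDiff_recFun_right lam c).differentiable (by simp)) _) w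

/-- `φ_0 = id`. -/
theorem recPhi_zero : recPhi lam 0 = id := by
  funext y; apply Subtype.ext; simp [recFun_zero]

variable {lam}

/-- **Injective differentials** when `λ ‖DG‖ ≤ 1/2`. -/
theorem injective_mfderiv_recPhi {C : ℝ} (hC : ∀ z, ‖fderiv ℝ G z‖ ≤ C) (hlam0 : 0 ≤ lam)
    (hlam : lam * C ≤ 1 / 2) (c : P1) (y : Minkowski.slice) :
    Function.Injective (mfderiv 𝓘(ℝ, E3) 𝓘(ℝ, E3) (recPhi lam c) y) := by
  intro u w huw
  have h : fderiv ℝ (recFun lam c) y u = fderiv ℝ (recFun lam c) y w := by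
    rw [← mfderiv_recPhi_apply lam c y u, ← mfderiv_recPhi_apply lam c y w]; exact huw
  rw [fderiv_recFun] at h
  refine Deformation.injective_one_add_of_norm_le ?_ h
  calc ‖lam • fderiv ℝ G ((c 0) • (y : E3) - dir)‖
      = lam * ‖fderiv ℝ G ((c 0) • (y : E3) - dir)‖ := by rw [norm_smul, Real.norm_of_nonneg hlam0]
    _ ≤ lam * C := by gcongr; exact hC _
    _ ≤ 1 / 2 := hlam

variable (lam) in
/-- **The receding gauge family** `F(c) = φ_c^* trivialData`. -/
abbrev recFam (hinj : ∀ c (y : Minkowski.slice),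
    Function.Injective (mfderiv 𝓘(ℝ, E3) 𝓘(ℝ, E3) (recPhi lam c) y)) (c : P1) :
    InitialDataSet 𝓘(ℝ, E3) Minkowski.slice :=
  trivialData.comap (recPhi lam c) (contMDiff_recPhi lam c) (hinj c)

variable {hinj : ∀ c (y : Minkowski.slice),
    Function.Injective (mfderiv 𝓘(ℝ, E3) 𝓘(ℝ, E3) (recPhi lam c) y)}

/-- **`F(0) = trivialData`** (`φ_0 = id`). -/
theorem recFam_zero : recFam lam hinj 0 = trivialData :=
  trivialData.comap_eq_self_of_eq_id _ _ (recPhi_zero lam)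

/-- The scalar product of `F(c)`: `δ(DΦ̂_c u, DΦ̂_c w)`. -/
theorem recFam_h_inner_apply (c : P1) (y : Minkowski.slice) (u w : E3) :
    (recFam lam hinj c).h.inner y u w =
      ⟪fderiv ℝ (recFun lam c) y u, fderiv ℝ (recFun lam c) y w⟫ := by
  rw [recFam, InitialDataSet.comap_h_inner, mfderiv_recPhi_apply, mfderiv_recPhi_apply,
    trivialData_h_inner]
  rfl

/-- The tensor `k` of `F(c)` vanishes (pullback of `k = 0`). -/
@[simp] theorem recFam_k_apply (c : P1) (y : Minkowski.slice) (u w : E3) :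
    (recFam lam hinj c).k y u w = 0 := by
  rw [recFam, InitialDataSet.comap_k, trivialData_k]
  rfl

/-- **`F(c) = F(0)` off the moving ball**: where `1/4 < ‖c₀ y − v‖` the scalar product is `δ`. -/
theorem recFam_h_inner_of_far {c : P1} {y : Minkowski.slice} (h : 1 / 4 < ‖(c 0) • (y : E3) - dir‖)
    (u w : E3) : (recFam lam hinj c).h.inner y u w = ⟪u, w⟫ := by
  rw [recFam_h_inner_apply, fderiv_recFun_of_far lam h]
  rfl

/-- In particular `F(c)` agrees with the trivial datum on the ball `‖y‖ < 1/(2|c₀|)` (for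
`c₀ ≠ 0`; for `c = 0` everywhere) — the only sense in which `F c → F 0`. -/
theorem recFam_h_inner_of_norm_lt {c : P1} {y : Minkowski.slice}
    (hy : |c 0| * ‖(y : E3)‖ < 3 / 4) (u w : E3) :
    (recFam lam hinj c).h.inner y u w = trivialData.h.inner y u w := by
  rw [recFam_h_inner_of_far (norm_sub_dir_gt hy), trivialData_h_inner]
  rfl

/-- **At the centre `y_c = v/c₀` the scalar product is `(1 + λ)² δ`.** -/
theorem recFam_h_inner_centre {c : P1} (hc : c 0 ≠ 0) (u w : E3) :
    (recFam lam hinj c).h.inner ⟨(c 0)⁻¹ • dir, Minkowski.mem_slice _⟩ u w =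
      (1 + lam) ^ 2 * ⟪u, w⟫ := by
  rw [recFam_h_inner_apply]
  change ⟪fderiv ℝ (recFun lam c) ((c 0)⁻¹ • dir) u, fderiv ℝ (recFun lam c) ((c 0)⁻¹ • dir) w⟫ = _
  rw [fderiv_recFun_centre lam hc]
  change ⟪(1 + lam) • u, (1 + lam) • w⟫ = _
  rw [real_inner_smul_left, real_inner_smul_right]
  ring

end FamilyDef

end Summit.FinalStateConjecture.FinalStateConjecture.Theorems.WeakCosmicCensorshipMGHD.Negative

end
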